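import Literature.Computability.Cryptography.KitaevModePhaseEstimation
import Literature.Computability.QuantumComplexity.QFTQubits
import HarnessLib

/-!
# Kitaev's eigenvalue-measurement block on embedded control wires

Topic `Literature/Computability/Cryptography`; support for the discharge of
`VanDamSeroussi2002_gaussSumPhase_qsolvable`. `KitaevPhaseEstimationCircuit.lean` builds Kitaev's
circuit `H_controls; V; S³_σ; H_controls` (Kitaev 1995, §3 Remark 8, Lemma 8, Lemma 10) on the fixed
three-part layout `tri x y ρ` (inputs, then the `k` controls, then the work wires), and
`KitaevModePhaseEstimation.lean` proves its action on superpositions. The van Dam–Seroussi copy runs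
TWO such measurements (of the shift on the mode register that kicks back the character phases, and of
the shift on the periodised register: Kitaev 1995, §5, the Fourier transform as an eigenvalue
measurement) inside one large register whose control wires sit wherever the layout puts them. This
file re-proves the block's state-vector semantics for control wires given by an arbitrary EMBEDDING
`cw : Fin k ↪ Fin N` (labels rewritten along `cw` by `QFTQubits.writeB`):

* `KitaevEmb.hLayer cw`, **`hLayer_mulVec_basisState`** — `H` on the controls:
  `|w⟩ ↦ 2^{-k/2} Σ_{y'} (−1)^{(w∘cw)·y'} |w[cw ↦ y']⟩` (Nielsen–Chuang 2010, eq. (1.50), from the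
  tree's `hadamards_mulVec_basisState_signed`);
* `KitaevEmb.sssLayer cw σ`, `sssLayer_mulVec_basisState` — `S³` on the sine-test controls multiplies
  `|z⟩` by `sPhase σ (z ∘ cw)`;
* `KitaevEmb.block cw V σ` and **`block_mulVec_superposition`** — for a block `V` acting as the basis
  map `z ↦ A z` on the good labels, keeping the controls, and an input `Σ_z Ψ(z)|z⟩` supported on good
  labels with clean controls: the output is
  `2^{-k} Σ_z Ψ(z) Σ_{y,y'} (−i)^{#σ∧y} (−1)^{y·y'} |(A (z[cw ↦ y]))[cw ↦ y']⟩`.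

Everything is proved; the three definitions have bodies; no named fact.

## References

* A. Yu. Kitaev, arXiv:quant-ph/9511026 (1995), §3 (Remark 8, Lemma 8, Lemma 10), §5 [Kitaev1995].
* M. A. Nielsen, I. L. Chuang, CUP 2010, §1.4.4 eq. (1.50), §4.2 [NielsenChuang2010].
* W. van Dam, G. Seroussi, arXiv:quant-ph/0207131 (2002), §4 [VanDamSeroussi2002].
-/

noncomputable section

open Finset Matrix

namespace Literature.Computability.Cryptography

namespace KitaevEmb

open Literature.Computability.QuantumComplexity Literature.Computability.QuantumComplexity.QFTQubits Kitaev1995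

variable {N k : ℕ} (cw : Fin k ↪ Fin N)

/-! ### Labels rewritten along the controls -/

/-- **A label is a rewrite of `w` along `cw` iff it agrees with `w` off the controls**, its control
values being what was written. [folklore] -/
theorem eq_writeB_iff (w z : QReg N) (y : Fin k → Bool) :
    z = writeB cw w y ↔ (∀ i, i ∉ Set.range cw → z i = w i) ∧ z ∘ cw = y := by
  constructor
  · rintro rfl
    exact ⟨fun i hi => writeB_apply_of_not_mem cw w y hi, funext fun j => writeB_apply_ws cw w y j⟩
  · rintro ⟨hoff, hon⟩
    funext i
    by_cases hi : i ∈ Set.range cw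
    · obtain ⟨j, rfl⟩ := hi
      rw [writeB_apply_ws, ← hon]; rfl
    · rw [writeB_apply_of_not_mem cw w y hi, hoff i hi]

/-- Membership in the list of control wires. [folklore] -/
theorem mem_ofFn_iff (i : Fin N) : i ∈ List.ofFn cw ↔ i ∈ Set.range cw := by
  rw [List.mem_ofFn]; rfl

/-- The control wires are distinct. [folklore] -/
theorem nodup_ofFn : (List.ofFn cw).Nodup := List.nodup_ofFn.2 cw.injective

/-- `hSign` over the controls of `w` against `z` is `(−1)^{(w∘cw)·(z∘cw)}`. [folklore] -/
theorem hSign_ofFn (w z : QReg N) : hSign (List.ofFn cw) w z = ySign (w ∘ cw) (z ∘ cw) := by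
  rw [hSign, ySign, List.map_ofFn, List.prod_ofFn]
  rfl

/-! ### The Hadamard layer on the controls -/

/-- `H` on every control wire. [cite: Kitaev1995, §3 Remark 8] -/
def hLayer : List (QGate cliffordT N) := (List.ofFn cw).map hOn

/-- The Hadamard layer is oracle-free. [folklore] -/
theorem hLayer_isOracleFree : ∀ g ∈ hLayer cw, g.IsOracleFree := by
  intro g hg
  obtain ⟨i, -, rfl⟩ := List.mem_map.1 hg
  exact hOn_isOracleFree i

/-- **The Hadamard layer on the controls**: `|w⟩ ↦ 2^{-k/2} Σ_{y'} (−1)^{(w∘cw)·y'} |w[cw ↦ y']⟩`.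
[cite: NielsenChuang2010, §1.4.4 eq. (1.50)] -/
theorem hLayer_mulVec_basisState (w : QReg N) :
    (⟨hLayer cw⟩ : QCircuit cliffordT N).toMatrix 0 *ᵥ basisState w =
      invSqrt2 ^ k • ∑ y' : Fin k → Bool, ySign (w ∘ cw) y' • basisState (writeB cw w y') := by
  rw [hLayer, hadamards_mulVec_basisState_signed _ (nodup_ofFn cw)]
  ext z
  simp only [Pi.smul_apply, Finset.sum_apply, smul_eq_mul, basisState_apply, List.length_ofFn, mul_ite, mul_one, mul_zero]
  by_cases hP : ∀ i, i ∉ List.ofFn cw → z i = w i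
  · have hP' : ∀ i, i ∉ Set.range cw → z i = w i := fun i hi => hP i (by rwa [mem_ofFn_iff])
    rw [if_pos hP, Finset.sum_eq_single (z ∘ cw)]
    · rw [if_pos ((eq_writeB_iff cw w z _).2 ⟨hP', rfl⟩), hSign_ofFn]
    · intro y' _ hy'
      exact if_neg fun h => hy' ((eq_writeB_iff cw w z y').1 h).2.symm
    · intro h; exact absurd (Finset.mem_univ _) h
  · have hP' : ¬ ∀ i, i ∉ Set.range cw → z i = w i := fun h => hP fun i hi => h i (by rwa [← mem_ofFn_iff])
    rw [if_neg hP, Finset.sum_eq_zero fun y' _ => if_neg fun h => hP' ((eq_writeB_iff cw w z y').1 h).1, mul_zero]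

/-! ### The phase layer -/

/-- `S³ = S†` on every sine-test control (`σ j`). [cite: Kitaev1995, §3 Remark 8] -/
def sssLayer (σ : Fin k → Bool) : List (QGate cliffordT N) :=
  (List.finRange k).flatMap fun j => if σ j then [sOn (cw j), sOn (cw j), sOn (cw j)] else []

/-- The phase layer is oracle-free. [folklore] -/
theorem sssLayer_isOracleFree (σ : Fin k → Bool) : ∀ g ∈ sssLayer cw σ, g.IsOracleFree := by
  intro g hg
  simp only [sssLayer, List.mem_flatMap] at hg
  obtain ⟨j, -, hj⟩ := hg
  split_ifs at hj
  · simp only [List.mem_cons, List.not_mem_nil, or_false] at hj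
    rcases hj with rfl | rfl | rfl <;> exact sOn_isOracleFree _
  · simp at hj

/-- The phase layer over a list of controls multiplies `|z⟩` by `Π_{j ∈ L} (−i)^{[σ j ∧ z (cw j)]}`. [folklore] -/
theorem sssLayerL_mulVec_basisState (σ : Fin k → Bool) (L : List (Fin k)) (z : QReg N) :
    (⟨L.flatMap fun j => if σ j then [sOn (cw j), sOn (cw j), sOn (cw j)] else []⟩ : QCircuit cliffordT N).toMatrix 0 *ᵥ
        basisState z =
      (L.map fun j => if σ j && z (cw j) then -Complex.I else 1).prod • basisState z := by
  induction L with
  | nil => simp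
  | cons j L ih =>
    have hsplit : (⟨(j :: L).flatMap fun j => if σ j then [sOn (cw j), sOn (cw j), sOn (cw j)] else []⟩ : QCircuit cliffordT N) =
        (⟨if σ j then [sOn (cw j), sOn (cw j), sOn (cw j)] else []⟩ : QCircuit cliffordT N).append
          ⟨L.flatMap fun j => if σ j then [sOn (cw j), sOn (cw j), sOn (cw j)] else []⟩ := by
      simp [QCircuit.append]
    rw [hsplit, QCircuit.toMatrix_append, ← Matrix.mulVec_mulVec]
    have hhead : (⟨if σ j then [sOn (cw j), sOn (cw j), sOn (cw j)] else []⟩ : QCircuit cliffordT N).toMatrix 0 *ᵥ basisState z =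
        (if σ j && z (cw j) then -Complex.I else 1) • basisState z := by
      cases σ j
      · simp
      · simp only [if_true, Bool.true_and]
        exact sss_mulVec_basisState _ z
    rw [hhead, Matrix.mulVec_smul, ih, smul_smul, List.map_cons, List.prod_cons, mul_comm]

/-- **The phase layer**: multiplication of `|z⟩` by `sPhase σ (z ∘ cw) = (−i)^{#{j : σ j ∧ z (cw j)}}`.
[cite: Kitaev1995, §3 Remark 8] -/
theorem sssLayer_mulVec_basisState (σ : Fin k → Bool) (z : QReg N) :
    (⟨sssLayer cw σ⟩ : QCircuit cliffordT N).toMatrix 0 *ᵥ basisState z = sPhase σ (z ∘ cw) • basisState z := by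
  rw [sssLayer, sssLayerL_mulVec_basisState, ← List.ofFn_eq_map, List.prod_ofFn, sPhase]
  rfl

/-! ### The block and its action on superpositions -/

/-- **Kitaev's block on embedded controls**: `H_controls; V; S³_σ; H_controls`.
[cite: Kitaev1995, §3 (Remark 8, Lemma 8, Lemma 10)] -/
def block (V : List (QGate cliffordT N)) (σ : Fin k → Bool) : QCircuit cliffordT N :=
  ⟨hLayer cw ++ V ++ sssLayer cw σ ++ hLayer cw⟩

/-- Rewriting the controls twice. [folklore] -/
theorem writeB_writeB' (w : QReg N) (y y' : Fin k → Bool) : writeB cw (writeB cw w y) y' = writeB cw w y' := by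
  refine ((eq_writeB_iff cw w _ y').2 ⟨fun i hi => ?_, funext fun j => writeB_apply_ws cw _ y' j⟩)
  rw [writeB_apply_of_not_mem cw _ y' hi, writeB_apply_of_not_mem cw w y hi]

/-- **Kitaev's block on a superposition with clean controls.** Let `V` act as the basis map
`|z⟩ ↦ |A z⟩` on every good label, keep the controls (`A z ∘ cw = z ∘ cw`), and let goodness not
depend on the control values. Then on an input `Σ_z Ψ(z)|z⟩` supported on good labels with clean
controls the block outputs `2^{-k} Σ_z Ψ(z) Σ_{y,y'} (−i)^{#σ∧y} (−1)^{y·y'} |(A (z[cw ↦ y]))[cw ↦ y']⟩`.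
[cite: Kitaev1995, §3 (Remark 8, Lemma 8)] -/
theorem block_mulVec_superposition (V : List (QGate cliffordT N)) (σ : Fin k → Bool)
    (Good : QReg N → Prop) (A : QReg N → QReg N)
    (hV : ∀ z, Good z → (⟨V⟩ : QCircuit cliffordT N).toMatrix 0 *ᵥ basisState z = basisState (A z))
    (hA : ∀ z, Good z → A z ∘ cw = z ∘ cw)
    (hGood : ∀ z y, Good z → Good (writeB cw z y))
    (Ψ : QReg N → ℂ) (hΨ : ∀ z, Ψ z ≠ 0 → Good z ∧ z ∘ cw = fun _ => false) :
    (block cw V σ).toMatrix 0 *ᵥ (∑ z : QReg N, Ψ z • basisState z) =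
      ∑ z : QReg N, Ψ z • ((invSqrt2 ^ k * invSqrt2 ^ k) •
        ∑ y : Fin k → Bool, ∑ y' : Fin k → Bool, (sPhase σ y * ySign y y') • basisState (writeB cw (A (writeB cw z y)) y')) := by
  have hsplit : block cw V σ =
      ((((⟨hLayer cw⟩ : QCircuit cliffordT N).append ⟨V⟩).append ⟨sssLayer cw σ⟩).append ⟨hLayer cw⟩) := by
    simp [block, QCircuit.append]
  -- one good basis input with clean controls
  have hone : ∀ z, Good z → (z ∘ cw = fun _ => false) →
      (block cw V σ).toMatrix 0 *ᵥ basisState z =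
        (invSqrt2 ^ k * invSqrt2 ^ k) •
          ∑ y : Fin k → Bool, ∑ y' : Fin k → Bool, (sPhase σ y * ySign y y') • basisState (writeB cw (A (writeB cw z y)) y') := by
    intro z hg hz
    have hy0 : ∀ y : Fin k → Bool, ySign (z ∘ cw) y = 1 := fun y => by
      rw [hz, ySign]; exact prod_eq_one fun j _ => by simp
    rw [hsplit, QCircuit.toMatrix_append, QCircuit.toMatrix_append, QCircuit.toMatrix_append,
      ← Matrix.mulVec_mulVec, ← Matrix.mulVec_mulVec, ← Matrix.mulVec_mulVec, hLayer_mulVec_basisState,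
      Matrix.mulVec_smul, Matrix.mulVec_sum]
    simp_rw [hy0, one_smul, hV _ (hGood z _ hg)]
    rw [Matrix.mulVec_smul, Matrix.mulVec_sum]
    simp_rw [sssLayer_mulVec_basisState cw σ]
    rw [Matrix.mulVec_smul, Matrix.mulVec_sum]
    simp_rw [Matrix.mulVec_smul, hLayer_mulVec_basisState, smul_smul, Finset.smul_sum, smul_smul]
    refine Finset.sum_congr rfl fun y _ => Finset.sum_congr rfl fun y' _ => ?_
    have hctl : A (writeB cw z y) ∘ cw = y := by
      rw [hA _ (hGood z y hg)]; exact funext fun j => writeB_apply_ws cw z y j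
    rw [hctl]
    congr 1; ring
  rw [Matrix.mulVec_sum]
  refine Finset.sum_congr rfl fun z _ => ?_
  rw [Matrix.mulVec_smul]
  by_cases hz : Ψ z = 0
  · rw [hz, zero_smul, zero_smul]
  · obtain ⟨hg, hclean⟩ := hΨ z hz
    rw [hone z hg hclean]

end KitaevEmb

end Literature.Computability.Cryptography

end
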